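import Literature.NumberTheory.Rogawski1990.LocalTransferGlueCM
import Literature.NumberTheory.Rogawski1990.LocalAPacket
import Literature.NumberTheory.Rogawski1990.SmoothTransferSplitPlaceHSide
import Literature.NumberTheory.Automorphic.OrbitalMeasureCanonical
import Literature.NumberTheory.Automorphic.GLnLeviSmoothTransport
import Literature.NumberTheory.Automorphic.SmoothIndClosedCellNonzero
import Literature.NumberTheory.Automorphic.CMPrincipalSeriesJacquetEvalOne
import HarnessLib

/-!
# F0 · P3b · line «CMCharIdentityTest» ED. 5 — (C2-red) `stub_charDistReduction`: the `ξ`-twist ∕ linearity reduction of the stability of `χ_ξ`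

Cell `pub/hodgecm-mathlib`, crux H413 = `stmt-HodgeConjecture-24833`, route HCCMUnconditional; desk F0P3b-plan (g12) brief H4 of
`F0/P3b/PLAN-P3b.v14.F0P3b-plan-g12.md` §2 (signature `Sketch-briefs.F0P3b-plan-g12.lean` :78 ≡ tree stub
`Cruxes/H413/Lines/F0_P3b_CMCharIdentityTestPaydown.lean` ED. 5 :328 `stub_charDistReduction`); pen A-p19 (g21).  THEOREMS ONLY, sorry-free.
HONEST LABEL: HC_CM is proved only modulo the 2 remaining named inputs (hLiu418, h413) until rung 0 closes; this file discharges one BOOKKEEPING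
joint of print's «`χ_ξ` is a stable distribution» [Rogawski1990, §4.3 (4.3.1) p. 43; §12.5 pp. 183–187], not the analytic one (W1).

THE STATEMENT (C2-red, verbatim = the stub's Π-type with the line's `abbrev`s `Pl`, `HLoc` unfolded).  At a finite place `v` of `L⁺`, on
`H_v = U(Φ₂)(L⁺_v) × U(Φ₁)(L⁺_v)` with a Haar measure `ν_H` and a canonical orbital-measure family `m_H` on the `G`-regular classes: for a continuous
character `ξ_v : H_v →* ℂˣ` constant on the stable class of every `G`-regular element and test functions `f₁, f₂` (★ `IsLocSmooth`) with equal `G`-regular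
stable orbital integrals, `g := ξ_v · (f₁ − f₂)` is TEST, all its `G`-regular stable orbital integrals VANISH, and `χ_ξ(f₁) − χ_ξ(f₂) = ∫ g dν_H`
(★ `charDist ξ ν f = ∫ ξ·f dν`).  With (W1) «a test function with vanishing `G`-regular stable orbital integrals has Haar integral `0`» this gives (C2),
by the line's kernel-checked `charDistStableOfInvariant_of_line`.

THE PROOF (all ingredients ★).  (i) `ℂˣ` has no small subgroups and `H_v` is non-archimedean (★ `exists_openSubgroup_forall_unitsComplex_eq_one`, ★
`nonarchimedeanGroup_unitaryGroupOfForm_local`, Mathlib `Prod.instNonarchimedeanGroup`), so a continuous `ξ_v` is trivial on an open subgroup, hence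
LOCALLY CONSTANT (`MonoidHom.isLocallyConstant_of_continuous_unitsComplex`, generic); (ii) ★ `IsLocSmooth.mul_left`; (iii) a class-function weight comes
out of every orbital integral (★ `orbitalIntegral_mul_of_forall_conj_eq`; `ξ(yγy⁻¹) = ξ(γ)` as `ℂˣ` is abelian), and on the stable class of a `G`-regular `a`
the weight is the constant `ξ(a)` (hypothesis), so `Φ^st(a, ξ·d) = ξ(a)·Φ^st(a, d)` (Mathlib `mul_finsum_mem`); (iv) `Φ^st(a, ·)` is additive on test
functions at `G`-regular `a` (★ `localStableOrbitalIntegralH_add_of_isLocSmooth` at ★ `IsCanonical.isAdmissibleOn`), applied to `(f₁ − f₂) + f₂ = f₁`;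
(v) `integral_sub`, test × continuous being integrable (compact support, Haar finite on compacts).

* §1 (generic) `MonoidHom.apply_conj_eq_of_unitsComplex`, **`MonoidHom.isLocallyConstant_of_continuous_unitsComplex`**, `isLocSmooth_sub`,
  `isLocSmooth_unitsComplex_mul`, `stableOrbitalIntegralRel_mul_eq_of_forall` (the weight factorisation for ANY `st`, `m`), `integrable_unitsComplex_mul_of_isLocSmooth`.
* §2 (CM) `nonarchimedeanGroup_HLoc`, `stableOrbitalIntegralRel_sub_of_isLocSmooth`, **`charDistReduction`** (= the stub, closes it by `exact`).
-/

set_option autoImplicit false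
set_option linter.dupNamespace false

noncomputable section

open NumberField IsDedekindDomain MeasureTheory Topology Filter Set
open scoped Matrix MatrixGroups
open Literature.NumberTheory.Rogawski1990 Literature.NumberTheory.Automorphic Literature.NumberTheory.Automorphic.UnitaryGroup

namespace Summit.HodgeConjecture.HodgeConjecture.Cruxes.H413.F0P3bCharDistReduction

/-! ## §1 Generic pieces: continuous characters into `ℂˣ`, test functions, the weight factorisation of `Φ^st` -/

section Generic

variable {G : Type*} [Group G]

/-- A character into the ABELIAN group `ℂˣ` is a class function: `ξ(y γ y⁻¹) = ξ(γ)`. [cite: Rogawski1990, §4.3 (4.3.1) p. 43] -/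
theorem _root_.MonoidHom.apply_conj_eq_of_unitsComplex (ξ : G →* ℂˣ) (γ y : G) : ξ (y * γ * y⁻¹) = ξ γ := by
  rw [map_mul, map_mul, map_inv, mul_comm (ξ y) (ξ γ), mul_inv_cancel_right]

variable [TopologicalSpace G]

/-- **A continuous character `ξ : G →* ℂˣ` of a non-archimedean group is locally constant** (`ℂˣ` has no small subgroups, so `ξ` is trivial on an open subgroup
`K` — ★ `exists_openSubgroup_forall_unitsComplex_eq_one` — and then constant on every open coset `gK`). [cite: CartierCorvallis1979, §I.1] [cite: Rogawski1990, §12.5 p. 183] -/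
theorem _root_.MonoidHom.isLocallyConstant_of_continuous_unitsComplex [NonarchimedeanGroup G] (ξ : G →* ℂˣ) (hξ : Continuous fun x => (ξ x : ℂ)) :
    IsLocallyConstant fun x => (ξ x : ℂ) := by
  obtain ⟨K, hK⟩ := exists_openSubgroup_forall_unitsComplex_eq_one (⊤ : Subgroup G) (ξ.comp (Subgroup.subtype ⊤))
    (hξ.comp continuous_subtype_val)
  have hker : ∀ k : G, k ∈ (K : Set G) → ξ k = 1 := fun k hk => hK ⟨k, Subgroup.mem_top k⟩ hk
  refine (IsLocallyConstant.iff_exists_open _).2 fun g => ⟨(fun x => g⁻¹ * x) ⁻¹' (K : Set G), K.isOpen.preimage (continuous_const.mul continuous_id),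
    ?_, fun x hx => ?_⟩
  · rw [mem_preimage, inv_mul_cancel]
    exact K.one_mem
  · have hx' : ξ x = ξ g := by rw [← mul_inv_cancel_left g x, map_mul, hker _ hx, mul_one]
    simp only [hx']

omit [Group G] in
/-- Test functions are closed under subtraction. [cite: Rogawski1990, §1.6 p. 6] -/
theorem isLocSmooth_sub {φ ψ : G → ℂ} (hφ : IsLocSmooth φ) (hψ : IsLocSmooth ψ) : IsLocSmooth fun x => φ x - ψ x := by
  refine ⟨hφ.isLocallyConstant.sub hψ.isLocallyConstant, ?_⟩
  have h : (fun x => φ x - ψ x) = φ + fun x => -ψ x := by funext x; simp only [Pi.add_apply, sub_eq_add_neg]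
  rw [h]
  exact hφ.hasCompactSupport.add (hψ.hasCompactSupport.comp_left (g := fun z : ℂ => -z) neg_zero)

/-- `ξ · (f₁ − f₂)` is a test function for a continuous character `ξ` of a non-archimedean group and test `f₁, f₂`. [cite: Rogawski1990, §12.5 p. 183; §1.6 p. 6] -/
theorem isLocSmooth_unitsComplex_mul [NonarchimedeanGroup G] (ξ : G →* ℂˣ) (hξ : Continuous fun x => (ξ x : ℂ)) {f₁ f₂ : G → ℂ}
    (hf₁ : IsLocSmooth f₁) (hf₂ : IsLocSmooth f₂) : IsLocSmooth fun h => (ξ h : ℂ) * (f₁ h - f₂ h) :=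
  (isLocSmooth_sub hf₁ hf₂).mul_left (ξ.isLocallyConstant_of_continuous_unitsComplex hξ)

omit [TopologicalSpace G] in
/-- **The weight factorisation `Φ^st(a, ξ·d) = ξ(a)·Φ^st(a, d)`** for a character `ξ : G →* ℂˣ` constant on `{γ | st a γ}` (any relation `st`, any family `m`):
the weight `ξ` is a class function (`ℂˣ` abelian), comes out of each class orbital integral as `ξ(out c)` (★ `orbitalIntegral_mul_of_forall_conj_eq`), and
`ξ(out c) = ξ(a)` on the classes of the `st`-orbit of `a`. [cite: Rogawski1990, §4.3 (4.3.1) p. 43; §4.1 (4.1.2) p. 40] -/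
theorem stableOrbitalIntegralRel_mul_eq_of_forall [∀ γ : G, MeasurableSpace (G ⧸ Subgroup.centralizer ({γ} : Set G))]
    (st : G → G → Prop) (m : OrbitalMeasureFamily G) (ξ : G →* ℂˣ) (d : G → ℂ) (a : G) (hst : ∀ b : G, st a b → ξ a = ξ b) :
    stableOrbitalIntegralRel st m (fun h => (ξ h : ℂ) * d h) a = (ξ a : ℂ) * stableOrbitalIntegralRel st m d a := by
  rw [stableOrbitalIntegralRel_def, stableOrbitalIntegralRel_def, mul_finsum_mem]
  refine finsum_mem_congr rfl fun c hc => ?_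
  rw [classOrbitalIntegral_eq, classOrbitalIntegral_eq,
    orbitalIntegral_mul_of_forall_conj_eq _ _ (fun x => (ξ x : ℂ)) d (fun y => by rw [ξ.apply_conj_eq_of_unitsComplex]), hst _ hc]

/-- `ξ · f` is integrable for a continuous character `ξ` and a test function `f` against a measure finite on compacts. [cite: Rogawski1990, §12.5 p. 183] -/
theorem integrable_unitsComplex_mul_of_isLocSmooth [MeasurableSpace G] [OpensMeasurableSpace G] (μ : Measure G) [IsFiniteMeasureOnCompacts μ]
    (ξ : G →* ℂˣ) (hξ : Continuous fun x => (ξ x : ℂ)) {f : G → ℂ} (hf : IsLocSmooth f) : Integrable (fun h => (ξ h : ℂ) * f h) μ :=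
  (hξ.mul hf.continuous).integrable_of_hasCompactSupport hf.hasCompactSupport.mul_left

end Generic

/-! ## §2 The CM instance: `H_v = U(Φ₂)(L⁺_v) × U(Φ₁)(L⁺_v)` -/

section CM

variable (L : Type) [Field L] [NumberField L] [IsCMField L] (v : HeightOneSpectrum (𝓞 ↥(maximalRealSubfield L)))

/-- `H_v = U(Φ₂)(L⁺_v) × U(Φ₁)(L⁺_v)` is a non-archimedean group (★ `nonarchimedeanGroup_unitaryGroupOfForm_local` on each factor). [cite: PlatonovRapinchuk1994, §3.3] -/
theorem nonarchimedeanGroup_HLoc :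
    NonarchimedeanGroup ((cmDatum L 2 (Matrix.of fun i j : Fin 2 => if i.val + j.val + 1 = 2 then (1 : L) else 0)).Local v ×
      (cmDatum L 1 (Matrix.of fun i j : Fin 1 => if i.val + j.val + 1 = 1 then (1 : L) else 0)).Local v) := by
  haveI : NonarchimedeanGroup ((cmDatum L 2 (Matrix.of fun i j : Fin 2 => if i.val + j.val + 1 = 2 then (1 : L) else 0)).Local v) :=
    nonarchimedeanGroup_unitaryGroupOfForm_local (E := L) (c := IsCMField.complexConj L) (N := 2) (v := v)
      (J' := (adelicForm L 2 (Matrix.of fun i j : Fin 2 => if i.val + j.val + 1 = 2 then (1 : L) else 0)).map (adeleToLocal L v))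
  haveI : NonarchimedeanGroup ((cmDatum L 1 (Matrix.of fun i j : Fin 1 => if i.val + j.val + 1 = 1 then (1 : L) else 0)).Local v) :=
    nonarchimedeanGroup_unitaryGroupOfForm_local (E := L) (c := IsCMField.complexConj L) (N := 1) (v := v)
      (J' := (adelicForm L 1 (Matrix.of fun i j : Fin 1 => if i.val + j.val + 1 = 1 then (1 : L) else 0)).map (adeleToLocal L v))
  infer_instance

/-- **`Φ^st(a, f₁ − f₂) = Φ^st(a, f₁) − Φ^st(a, f₂)`** at a `G`-regular `a ∈ H_v` for test `f₁, f₂` and a family admissible on the `G`-regular classes (★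
`localStableOrbitalIntegralH_add_of_isLocSmooth` applied to `(f₁ − f₂) + f₂ = f₁`). [cite: Rogawski1990, §4.3 (4.3.1) p. 43] -/
theorem stableOrbitalIntegralRel_sub_of_isLocSmooth
    [∀ a : (cmDatum L 2 (Matrix.of fun i j : Fin 2 => if i.val + j.val + 1 = 2 then (1 : L) else 0)).Local v ×
        (cmDatum L 1 (Matrix.of fun i j : Fin 1 => if i.val + j.val + 1 = 1 then (1 : L) else 0)).Local v,
      MeasurableSpace (((cmDatum L 2 (Matrix.of fun i j : Fin 2 => if i.val + j.val + 1 = 2 then (1 : L) else 0)).Local v ×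
        (cmDatum L 1 (Matrix.of fun i j : Fin 1 => if i.val + j.val + 1 = 1 then (1 : L) else 0)).Local v) ⧸
        Subgroup.centralizer ({a} : Set ((cmDatum L 2 (Matrix.of fun i j : Fin 2 => if i.val + j.val + 1 = 2 then (1 : L) else 0)).Local v ×
          (cmDatum L 1 (Matrix.of fun i j : Fin 1 => if i.val + j.val + 1 = 1 then (1 : L) else 0)).Local v)))]
    [∀ a : (cmDatum L 2 (Matrix.of fun i j : Fin 2 => if i.val + j.val + 1 = 2 then (1 : L) else 0)).Local v ×
        (cmDatum L 1 (Matrix.of fun i j : Fin 1 => if i.val + j.val + 1 = 1 then (1 : L) else 0)).Local v,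
      BorelSpace (((cmDatum L 2 (Matrix.of fun i j : Fin 2 => if i.val + j.val + 1 = 2 then (1 : L) else 0)).Local v ×
        (cmDatum L 1 (Matrix.of fun i j : Fin 1 => if i.val + j.val + 1 = 1 then (1 : L) else 0)).Local v) ⧸
        Subgroup.centralizer ({a} : Set ((cmDatum L 2 (Matrix.of fun i j : Fin 2 => if i.val + j.val + 1 = 2 then (1 : L) else 0)).Local v ×
          (cmDatum L 1 (Matrix.of fun i j : Fin 1 => if i.val + j.val + 1 = 1 then (1 : L) else 0)).Local v)))]
    {mH : OrbitalMeasureFamily ((cmDatum L 2 (Matrix.of fun i j : Fin 2 => if i.val + j.val + 1 = 2 then (1 : L) else 0)).Local v ×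
      (cmDatum L 1 (Matrix.of fun i j : Fin 1 => if i.val + j.val + 1 = 1 then (1 : L) else 0)).Local v)}
    (hmH : mH.IsAdmissibleOn (IsLocalGRegular L v))
    (a : (cmDatum L 2 (Matrix.of fun i j : Fin 2 => if i.val + j.val + 1 = 2 then (1 : L) else 0)).Local v ×
      (cmDatum L 1 (Matrix.of fun i j : Fin 1 => if i.val + j.val + 1 = 1 then (1 : L) else 0)).Local v) (ha : IsLocalGRegular L v a)
    {f₁ f₂ : (cmDatum L 2 (Matrix.of fun i j : Fin 2 => if i.val + j.val + 1 = 2 then (1 : L) else 0)).Local v ×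
      (cmDatum L 1 (Matrix.of fun i j : Fin 1 => if i.val + j.val + 1 = 1 then (1 : L) else 0)).Local v → ℂ} (hf₁ : IsLocSmooth f₁) (hf₂ : IsLocSmooth f₂) :
    stableOrbitalIntegralRel (IsLocalStablyConjH L v) mH (fun h => f₁ h - f₂ h) a =
      stableOrbitalIntegralRel (IsLocalStablyConjH L v) mH f₁ a - stableOrbitalIntegralRel (IsLocalStablyConjH L v) mH f₂ a := by
  have h := localStableOrbitalIntegralH_add_of_isLocSmooth (L := L) (v := v) hmH a ha (fun h => f₁ h - f₂ h) f₂ (isLocSmooth_sub hf₁ hf₂) hf₂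
  have hsum : ((fun h => f₁ h - f₂ h) + f₂) = f₁ := by funext x; simp only [Pi.add_apply, sub_add_cancel]
  rw [hsum] at h
  rw [h, add_sub_cancel_right]

/-- **(C2-red) THE `ξ`-TWIST ∕ LINEARITY REDUCTION** — the registered statement of `stub_charDistReduction` (line «CMCharIdentityTest» ED. 5 :328), closed by `exact`:
for a continuous character `ξ_v` of `H_v` constant on the stable class of every `G`-regular element and test `f₁, f₂` with equal `G`-regular stable orbital
integrals (one canonical family `m_H`), `g := ξ_v·(f₁ − f₂)` is test, its `G`-regular stable orbital integrals vanish (`= ξ_v(a)·(Φ^st(a,f₁) − Φ^st(a,f₂)) = 0`), and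
`χ_ξ(f₁) − χ_ξ(f₂) = ∫ g dν_H`. [cite: Rogawski1990, §4.3 (4.3.1) p. 43; §12.5 pp. 183–187] -/
theorem charDistReduction :
  ∀ (L : Type) [Field L] [NumberField L] [IsCMField L] (v : HeightOneSpectrum (𝓞 ↥(maximalRealSubfield L)))
    [MeasurableSpace ((cmDatum L 2 (Matrix.of fun i j : Fin 2 => if i.val + j.val + 1 = 2 then (1 : L) else 0)).Local v ×
      (cmDatum L 1 (Matrix.of fun i j : Fin 1 => if i.val + j.val + 1 = 1 then (1 : L) else 0)).Local v)]
    [BorelSpace ((cmDatum L 2 (Matrix.of fun i j : Fin 2 => if i.val + j.val + 1 = 2 then (1 : L) else 0)).Local v ×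
      (cmDatum L 1 (Matrix.of fun i j : Fin 1 => if i.val + j.val + 1 = 1 then (1 : L) else 0)).Local v)]
    (νH : Measure ((cmDatum L 2 (Matrix.of fun i j : Fin 2 => if i.val + j.val + 1 = 2 then (1 : L) else 0)).Local v ×
      (cmDatum L 1 (Matrix.of fun i j : Fin 1 => if i.val + j.val + 1 = 1 then (1 : L) else 0)).Local v)) [νH.IsHaarMeasure] [νH.IsMulRightInvariant],
    letI : ∀ a : (cmDatum L 2 (Matrix.of fun i j : Fin 2 => if i.val + j.val + 1 = 2 then (1 : L) else 0)).Local v ×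
        (cmDatum L 1 (Matrix.of fun i j : Fin 1 => if i.val + j.val + 1 = 1 then (1 : L) else 0)).Local v,
      MeasurableSpace (((cmDatum L 2 (Matrix.of fun i j : Fin 2 => if i.val + j.val + 1 = 2 then (1 : L) else 0)).Local v ×
        (cmDatum L 1 (Matrix.of fun i j : Fin 1 => if i.val + j.val + 1 = 1 then (1 : L) else 0)).Local v) ⧸
        Subgroup.centralizer ({a} : Set ((cmDatum L 2 (Matrix.of fun i j : Fin 2 => if i.val + j.val + 1 = 2 then (1 : L) else 0)).Local v ×
          (cmDatum L 1 (Matrix.of fun i j : Fin 1 => if i.val + j.val + 1 = 1 then (1 : L) else 0)).Local v))) := fun _ => borel _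
    haveI : ∀ a : (cmDatum L 2 (Matrix.of fun i j : Fin 2 => if i.val + j.val + 1 = 2 then (1 : L) else 0)).Local v ×
        (cmDatum L 1 (Matrix.of fun i j : Fin 1 => if i.val + j.val + 1 = 1 then (1 : L) else 0)).Local v,
      BorelSpace (((cmDatum L 2 (Matrix.of fun i j : Fin 2 => if i.val + j.val + 1 = 2 then (1 : L) else 0)).Local v ×
        (cmDatum L 1 (Matrix.of fun i j : Fin 1 => if i.val + j.val + 1 = 1 then (1 : L) else 0)).Local v) ⧸
        Subgroup.centralizer ({a} : Set ((cmDatum L 2 (Matrix.of fun i j : Fin 2 => if i.val + j.val + 1 = 2 then (1 : L) else 0)).Local v ×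
          (cmDatum L 1 (Matrix.of fun i j : Fin 1 => if i.val + j.val + 1 = 1 then (1 : L) else 0)).Local v))) := fun _ => ⟨rfl⟩
    ∀ (mH : OrbitalMeasureFamily ((cmDatum L 2 (Matrix.of fun i j : Fin 2 => if i.val + j.val + 1 = 2 then (1 : L) else 0)).Local v ×
      (cmDatum L 1 (Matrix.of fun i j : Fin 1 => if i.val + j.val + 1 = 1 then (1 : L) else 0)).Local v)), mH.IsCanonical (IsLocalGRegular L v) νH →
      ∀ (ξv : (cmDatum L 2 (Matrix.of fun i j : Fin 2 => if i.val + j.val + 1 = 2 then (1 : L) else 0)).Local v ×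
          (cmDatum L 1 (Matrix.of fun i j : Fin 1 => if i.val + j.val + 1 = 1 then (1 : L) else 0)).Local v →* ℂˣ), Continuous (fun x => (ξv x : ℂ)) →
      (∀ a b : (cmDatum L 2 (Matrix.of fun i j : Fin 2 => if i.val + j.val + 1 = 2 then (1 : L) else 0)).Local v ×
          (cmDatum L 1 (Matrix.of fun i j : Fin 1 => if i.val + j.val + 1 = 1 then (1 : L) else 0)).Local v,
        IsLocalGRegular L v a → IsLocalStablyConjH L v a b → ξv a = ξv b) →
      ∀ (fH₁ fH₂ : (cmDatum L 2 (Matrix.of fun i j : Fin 2 => if i.val + j.val + 1 = 2 then (1 : L) else 0)).Local v ×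
          (cmDatum L 1 (Matrix.of fun i j : Fin 1 => if i.val + j.val + 1 = 1 then (1 : L) else 0)).Local v → ℂ), IsLocSmooth fH₁ → IsLocSmooth fH₂ →
        (∀ a : (cmDatum L 2 (Matrix.of fun i j : Fin 2 => if i.val + j.val + 1 = 2 then (1 : L) else 0)).Local v ×
            (cmDatum L 1 (Matrix.of fun i j : Fin 1 => if i.val + j.val + 1 = 1 then (1 : L) else 0)).Local v, IsLocalGRegular L v a →
          stableOrbitalIntegralRel (IsLocalStablyConjH L v) mH fH₁ a = stableOrbitalIntegralRel (IsLocalStablyConjH L v) mH fH₂ a) →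
        IsLocSmooth (fun h => (ξv h : ℂ) * (fH₁ h - fH₂ h)) ∧
          (∀ a : (cmDatum L 2 (Matrix.of fun i j : Fin 2 => if i.val + j.val + 1 = 2 then (1 : L) else 0)).Local v ×
              (cmDatum L 1 (Matrix.of fun i j : Fin 1 => if i.val + j.val + 1 = 1 then (1 : L) else 0)).Local v, IsLocalGRegular L v a →
            stableOrbitalIntegralRel (IsLocalStablyConjH L v) mH (fun h => (ξv h : ℂ) * (fH₁ h - fH₂ h)) a = 0) ∧
          charDist ξv νH fH₁ - charDist ξv νH fH₂ = ∫ h, (ξv h : ℂ) * (fH₁ h - fH₂ h) ∂νH := by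
  intro L _ _ _ v _ _ νH _ _ mH hmH ξv hξ hst fH₁ fH₂ hf₁ hf₂ heq
  letI : ∀ a : (cmDatum L 2 (Matrix.of fun i j : Fin 2 => if i.val + j.val + 1 = 2 then (1 : L) else 0)).Local v ×
        (cmDatum L 1 (Matrix.of fun i j : Fin 1 => if i.val + j.val + 1 = 1 then (1 : L) else 0)).Local v,
      MeasurableSpace (((cmDatum L 2 (Matrix.of fun i j : Fin 2 => if i.val + j.val + 1 = 2 then (1 : L) else 0)).Local v ×
        (cmDatum L 1 (Matrix.of fun i j : Fin 1 => if i.val + j.val + 1 = 1 then (1 : L) else 0)).Local v) ⧸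
        Subgroup.centralizer ({a} : Set ((cmDatum L 2 (Matrix.of fun i j : Fin 2 => if i.val + j.val + 1 = 2 then (1 : L) else 0)).Local v ×
          (cmDatum L 1 (Matrix.of fun i j : Fin 1 => if i.val + j.val + 1 = 1 then (1 : L) else 0)).Local v))) := fun _ => borel _
  haveI : ∀ a : (cmDatum L 2 (Matrix.of fun i j : Fin 2 => if i.val + j.val + 1 = 2 then (1 : L) else 0)).Local v ×
        (cmDatum L 1 (Matrix.of fun i j : Fin 1 => if i.val + j.val + 1 = 1 then (1 : L) else 0)).Local v,
      BorelSpace (((cmDatum L 2 (Matrix.of fun i j : Fin 2 => if i.val + j.val + 1 = 2 then (1 : L) else 0)).Local v ×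
        (cmDatum L 1 (Matrix.of fun i j : Fin 1 => if i.val + j.val + 1 = 1 then (1 : L) else 0)).Local v) ⧸
        Subgroup.centralizer ({a} : Set ((cmDatum L 2 (Matrix.of fun i j : Fin 2 => if i.val + j.val + 1 = 2 then (1 : L) else 0)).Local v ×
          (cmDatum L 1 (Matrix.of fun i j : Fin 1 => if i.val + j.val + 1 = 1 then (1 : L) else 0)).Local v))) := fun _ => ⟨rfl⟩
  haveI := nonarchimedeanGroup_HLoc L v
  refine ⟨isLocSmooth_unitsComplex_mul ξv hξ hf₁ hf₂, fun a ha => ?_, ?_⟩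
  · have h1 := stableOrbitalIntegralRel_mul_eq_of_forall (IsLocalStablyConjH L v) mH ξv (fun h => fH₁ h - fH₂ h) a (fun b hb => hst a b ha hb)
    have h2 := stableOrbitalIntegralRel_sub_of_isLocSmooth L v hmH.isAdmissibleOn a ha hf₁ hf₂
    rw [h2, heq a ha, sub_self, mul_zero] at h1
    exact h1
  · rw [charDist_def, charDist_def, ← integral_sub (integrable_unitsComplex_mul_of_isLocSmooth νH ξv hξ hf₁)
      (integrable_unitsComplex_mul_of_isLocSmooth νH ξv hξ hf₂)]
    refine integral_congr_ae (Eventually.of_forall fun h => ?_)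
    simp only [mul_sub]

end CM

end Summit.HodgeConjecture.HodgeConjecture.Cruxes.H413.F0P3bCharDistReduction

end
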